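import Literature.AlgebraicGeometry.HodgeTheory.QuaternionicQuarticDoublePlaneChart
import Mathlib.AlgebraicGeometry.OpenImmersion
import HarnessLib

/-!
# The étale deck chart IS the basic open `D(h)` of the double-plane chart: `DeckRing a ≃+* (DoublePlaneRing a)_h̄`

Layer `Literature/AlgebraicGeometry/HodgeTheory`. Definitions + proved API (no named fact, nothing conditional). Sequel of
`QuaternionicQuarticDoublePlaneChart` (the double-plane chart `DoublePlaneRing a = R[u₀, u₁, s, t]/(c − s²σc, t² − sαψ)`
of the quaternionic quartic multiple plane `V_(c,ψ) : x₃⁴x₂^{2e} = c(σc)³((x₀ − x₁)ψ)²` and the two bridge maps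
`toDeck : s ↦ w₁/σc, t ↦ w/σc`, `ofDeck : w ↦ tσc, w₁ ↦ sσc, w₂ ↦ tsσc, v ↦ 1/h̄`). Written by the prover seat
`leafhand-hodge-q8symplecticpowers-4` (g4, cell `pub-hsemireg`) for route `HodgeConjecture/Q8SymplecticPowers` (crux K1Q,
stmt-HodgeConjecture-24190), brick **Zb-3 «double-plane bridge»** of the S1 programme (`stub_regularVeryGeneralQ`).

* `ofDeck_toDeck` — `ofDeck ∘ toDeck` is the localisation map `DoublePlaneRing a → (DoublePlaneRing a)_h̄`;
* `toDeckAway` — the extension of `toDeck` to `(DoublePlaneRing a)_h̄` (`toDeck h̄ = h` is a unit of the deck ring),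
  `toDeckAway_ofDeck` — it is a left inverse of `ofDeck` (`w = (w/σc)σc`, `w₁ = (w₁/σc)σc`, `w₂ = w w₁/σc`, `v = 1/h`),
  `ofDeck_toDeckAway` — and a right inverse (two ring maps out of a localisation agreeing on `DoublePlaneRing a`);
* **`deckRingEquivAway : DeckRing a ≃+* Localization.Away h̄`** — the étale deck chart of the normalised quaternionic
  quartic cover (`QuaternionicQuarticDeckChart`) is the basic open `D(h)`, `h = c·σc·α·ψ`, of the double-plane chart;
* **`isOpenImmersion_spec_map_toDeck`** — hence `Spec (DeckRing a) ⟶ Spec (DoublePlaneRing a)` is an open immersion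
  (Hartshorne II 2.3 (b)): every model of `V_(c,ψ)` (birational to the deck chart, `QuaternionicQuarticDeckChartBirational`)
  maps birationally onto an open of the DOUBLE PLANE `t² = s·α·ψ` over the rational surface `{c = s²σc}` — the model on
  which the irregularity (`q = 0`, Zariski ∕ Naie Thm. 3.1) and the eigen-`h^{2,0}` counts of the route are computed in
  print. The plane coordinates `(s, y = σc)` are the business of `QuaternionicQuarticDoublePlaneCoordinates`.

Honest scope: explicit commutative algebra for one family of surfaces; nothing here bears on HC; S1 ∕ K1Q NOT proved here.

## References

* [Naie2007] D. Naie, The irregularity of cyclic multiple planes after Zariski, Enseign. Math. 53 (2007), §1.2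
  (normalization procedure, Example 1) and Thm. 3.1 [held: paper:arxiv-math_0603427].
* [Zariski1929] O. Zariski, On the linear connection index of the algebraic surfaces zⁿ = f(x, y), PNAS 15 (1929).
* [Hartshorne1977] R. Hartshorne, Algebraic Geometry (1977), II Prop. 2.3 (b) (`D(h) = Spec A_h` is open in `Spec A`).
* [Kollar2007] J. Kollár, Lectures on Resolution of Singularities (2007), §3.3.
-/

noncomputable section

open MvPolynomial

namespace Literature.AlgebraicGeometry.HodgeTheory.Q8Family

universe v

/-- A combination of two deck relations lies in the deck ideal. [folklore] -/
private theorem mem_deckIdeal_of_eq₂' {R : Type v} [CommRing R] {e : ℕ} (a : CIdx e → R)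
    {p u u' : MvPolynomial (Fin 6) R} (i j : Fin 7) (h : p = u * rel a i + u' * rel a j) : p ∈ deckIdeal a := by
  rw [h]
  exact Ideal.add_mem _ (Ideal.mul_mem_left _ u (rel_mem_deckIdeal a i))
    (Ideal.mul_mem_left _ u' (rel_mem_deckIdeal a j))

/-! ### The two composites: the deck chart is the basic open `D(h)` of the double-plane chart -/

section Equiv

variable {R : Type v} [CommRing R] {e : ℕ} (a : CIdx e → R)

/-- `(1/σc)·σc = 1` on the deck chart: `ofDeckPoly (v c α ψ) · σc = 1` in the localisation.
[cite: Kollar2007, §3.3] -/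
theorem ofDeckPoly_invC'U_mul : ofDeckPoly a (invC'U a) * awayMk a (c₄' a) = 1 := by
  simp only [invC'U, map_mul, ofDeckPoly_X5, ofDeckPoly_cU, ofDeckPoly_αU, ofDeckPoly_ψU]
  have h := awayMk_h₄_mul_invSelf a
  simp only [h₄, map_mul] at h
  linear_combination h

/-- **`ofDeck ∘ toDeck` is the localisation map** `DoublePlaneRing a → Localization.Away h̄`.
[cite: Hartshorne1977, II Prop. 2.3 (b)] -/
theorem ofDeck_toDeck (x : DoublePlaneRing a) :
    ofDeck a (toDeck a x) = algebraMap (DoublePlaneRing a) (Localization.Away (hBar a)) x := by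
  obtain ⟨p, rfl⟩ := Ideal.Quotient.mk_surjective x
  change ((ofDeck a).comp ((toDeck a).comp (Ideal.Quotient.mkₐ R (dpIdeal a)))) p = awayMk a p
  congr 1
  refine MvPolynomial.algHom_ext fun i => ?_
  have h1 := ofDeckPoly_invC'U_mul a
  fin_cases i
  · simp [awayMk]
  · simp [awayMk]
  · simp only [AlgHom.comp_apply, Ideal.Quotient.mkₐ_eq_mk, toDeck_mk, toDeckPoly_X2, ofDeck_mk, map_mul,
      ofDeckPoly_X3, Fin.reduceFinMk]
    linear_combination (awayMk a (X 2)) * h1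
  · simp only [AlgHom.comp_apply, Ideal.Quotient.mkₐ_eq_mk, toDeck_mk, toDeckPoly_X3, ofDeck_mk, map_mul,
      ofDeckPoly_X2, Fin.reduceFinMk]
    linear_combination (awayMk a (X 3)) * h1

/-- The extension of `toDeck` to the localisation at `h̄` (which `toDeck` maps to the unit `h` of the deck ring).
[cite: Hartshorne1977, II Prop. 2.3 (b)] -/
def toDeckAway : Localization.Away (hBar a) →+* DeckRing a :=
  IsLocalization.Away.lift (hBar a) (g := (toDeck a).toRingHom) (isUnit_toDeck_hBar a)

/-- `toDeckAway` extends `toDeck`. [cite: Hartshorne1977, II Prop. 2.3 (b)] -/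
@[simp] theorem toDeckAway_algebraMap (x : DoublePlaneRing a) :
    toDeckAway a (algebraMap (DoublePlaneRing a) (Localization.Away (hBar a)) x) = toDeck a x :=
  IsLocalization.Away.lift_eq (hBar a) (isUnit_toDeck_hBar a) x

/-- `toDeckAway (1/h̄) = v`. [cite: Hartshorne1977, II Prop. 2.3 (b)] -/
theorem toDeckAway_invSelf :
    toDeckAway a (IsLocalization.Away.invSelf (hBar a)) = Ideal.Quotient.mk (deckIdeal a) (X 5) := by
  have h1 : toDeckAway a (IsLocalization.Away.invSelf (hBar a)) * Ideal.Quotient.mk (deckIdeal a) (hU a) = 1 := by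
    rw [← toDeck_hBar, ← toDeckAway_algebraMap, ← map_mul, mul_comm]
    change toDeckAway a (awayMk a (h₄ a) * IsLocalization.Away.invSelf (hBar a)) = 1
    rw [awayMk_h₄_mul_invSelf, map_one]
  have h2 := mk_X5_mul_mk_hU a
  calc toDeckAway a (IsLocalization.Away.invSelf (hBar a))
      = toDeckAway a (IsLocalization.Away.invSelf (hBar a)) *
          (Ideal.Quotient.mk (deckIdeal a) (X 5) * Ideal.Quotient.mk (deckIdeal a) (hU a)) := by rw [h2, mul_one]
    _ = Ideal.Quotient.mk (deckIdeal a) (X 5) *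
          (toDeckAway a (IsLocalization.Away.invSelf (hBar a)) * Ideal.Quotient.mk (deckIdeal a) (hU a)) := by ring
    _ = Ideal.Quotient.mk (deckIdeal a) (X 5) := by rw [h1, mul_one]

/-- **`toDeckAway ∘ ofDeck = id`** on the deck ring: `w = (w/σc)·σc`, `w₁ = (w₁/σc)·σc`, `w₂ = w w₁/σc`, `v = 1/h`.
[cite: Naie2007, §1.2 (normalization procedure) and Example 1] [cite: Hartshorne1977, II Prop. 2.3 (b)] -/
theorem toDeckAway_ofDeck (y : DeckRing a) : toDeckAway a (ofDeck a y) = y := by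
  obtain ⟨p, rfl⟩ := Ideal.Quotient.mk_surjective y
  change ((toDeckAway a).comp ((ofDeck a).toRingHom.comp (Ideal.Quotient.mk (deckIdeal a)))) p =
    Ideal.Quotient.mk (deckIdeal a) p
  congr 1
  refine MvPolynomial.ringHom_ext (fun r => ?_) (fun i => ?_)
  · change toDeckAway a (ofDeckPoly a (C r)) = Ideal.Quotient.mk (deckIdeal a) (C r)
    rw [← MvPolynomial.algebraMap_eq, AlgHom.commutes,
      IsScalarTower.algebraMap_apply R (DoublePlaneRing a) (Localization.Away (hBar a)) r,
      toDeckAway_algebraMap, AlgHom.commutes]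
    rfl
  · change toDeckAway a (ofDeckPoly a (X i)) = Ideal.Quotient.mk (deckIdeal a) (X i)
    fin_cases i
    · simp only [Fin.reduceFinMk, ofDeckPoly_X0, awayMk_apply, toDeckAway_algebraMap, toDeck_mk, toDeckPoly_X0]
    · simp only [Fin.reduceFinMk, ofDeckPoly_X1, awayMk_apply, toDeckAway_algebraMap, toDeck_mk, toDeckPoly_X1]
    · simp only [Fin.reduceFinMk, ofDeckPoly_X2, awayMk_apply, toDeckAway_algebraMap, toDeck_mk]
      rw [map_mul, toDeckPoly_X3, toDeckPoly_c₄', Ideal.Quotient.eq]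
      -- `(w/σc)·σc − w = w·r₇`
      exact mem_deckIdeal_of_eq₂' a 6 6 (u := X 2) (u' := 0) (by simp only [rel, invC'U, hU]; ring)
    · simp only [Fin.reduceFinMk, ofDeckPoly_X3, awayMk_apply, toDeckAway_algebraMap, toDeck_mk]
      rw [map_mul, toDeckPoly_X2, toDeckPoly_c₄', Ideal.Quotient.eq]
      -- `(w₁/σc)·σc − w₁ = w₁·r₇`
      exact mem_deckIdeal_of_eq₂' a 6 6 (u := X 3) (u' := 0) (by simp only [rel, invC'U, hU]; ring)
    · simp only [Fin.reduceFinMk, ofDeckPoly_X4, awayMk_apply, toDeckAway_algebraMap, toDeck_mk]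
      rw [show toDeckPoly a (X 3 * X 2 * c₄' a) = X 2 * invC'U a * (X 3 * invC'U a) * cU' a by
        simp only [map_mul, toDeckPoly_X3, toDeckPoly_X2, toDeckPoly_c₄'], Ideal.Quotient.eq]
      -- `(w/σc)(w₁/σc)σc − w₂ = (1/σc)²σc·r₄ + w₂·(vh + 1)·r₇`
      exact mem_deckIdeal_of_eq₂' a 3 6 (u := invC'U a ^ 2 * cU' a) (u' := X 4 * (X 5 * hU a + 1))
        (by simp only [rel, invC'U, hU]; ring)
    · simp only [Fin.reduceFinMk, ofDeckPoly_X5, toDeckAway_invSelf]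

/-- **`ofDeck ∘ toDeckAway = id`** on the localisation (two ring maps out of `(DoublePlaneRing a)_h̄` that agree on
`DoublePlaneRing a`). [cite: Hartshorne1977, II Prop. 2.3 (b)] -/
theorem ofDeck_comp_toDeckAway :
    (ofDeck a).toRingHom.comp (toDeckAway a) = RingHom.id (Localization.Away (hBar a)) := by
  refine IsLocalization.ringHom_ext (Submonoid.powers (hBar a)) (RingHom.ext fun x => ?_)
  change ofDeck a (toDeckAway a (algebraMap (DoublePlaneRing a) (Localization.Away (hBar a)) x)) =
    algebraMap (DoublePlaneRing a) (Localization.Away (hBar a)) x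
  rw [toDeckAway_algebraMap, ofDeck_toDeck]

/-- `ofDeck (toDeckAway z) = z`. [cite: Hartshorne1977, II Prop. 2.3 (b)] -/
theorem ofDeck_toDeckAway (z : Localization.Away (hBar a)) : ofDeck a (toDeckAway a z) = z :=
  RingHom.congr_fun (ofDeck_comp_toDeckAway a) z

/-- **The étale deck chart is the basic open `D(h)` of the double-plane chart**: `DeckRing a ≃+* (DoublePlaneRing a)_h̄`,
`w ↦ t·σc`, `w₁ ↦ s·σc`, `w₂ ↦ t·s·σc`, `v ↦ 1/h̄`, with inverse `s ↦ w₁/σc`, `t ↦ w/σc`.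
[cite: Naie2007, §1.2 (normalization procedure) and Example 1] [cite: Zariski1929] [cite: Hartshorne1977, II Prop. 2.3 (b)] -/
def deckRingEquivAway : DeckRing a ≃+* Localization.Away (hBar a) where
  toFun := ofDeck a
  invFun := toDeckAway a
  left_inv := toDeckAway_ofDeck a
  right_inv := ofDeck_toDeckAway a
  map_mul' := map_mul _
  map_add' := map_add _

/-- The equivalence is `ofDeck`. [cite: Hartshorne1977, II Prop. 2.3 (b)] -/
@[simp] theorem deckRingEquivAway_apply (y : DeckRing a) : deckRingEquivAway a y = ofDeck a y := rfl

/-- The inverse equivalence is `toDeckAway`. [cite: Hartshorne1977, II Prop. 2.3 (b)] -/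
@[simp] theorem deckRingEquivAway_symm_apply (z : Localization.Away (hBar a)) :
    (deckRingEquivAway a).symm z = toDeckAway a z := rfl

/-- In particular `toDeck` is injective up to `h̄`-torsion and `ofDeck` is injective outright.
[cite: Hartshorne1977, II Prop. 2.3 (b)] -/
theorem ofDeck_injective : Function.Injective (ofDeck a) := (deckRingEquivAway a).injective

/-- **`Spec` of the bridge is an open immersion**: `Spec (DeckRing a) ⟶ Spec (DoublePlaneRing a)` (induced by `toDeck`)
is the basic open `D(h̄)` followed by an isomorphism. [cite: Hartshorne1977, II Prop. 2.3 (b)] -/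
theorem isOpenImmersion_spec_map_toDeck :
    AlgebraicGeometry.IsOpenImmersion
      (AlgebraicGeometry.Spec.map (CommRingCat.ofHom (toDeck a).toRingHom)) := by
  have e : (toDeckAway a).comp (algebraMap (DoublePlaneRing a) (Localization.Away (hBar a))) =
      (toDeck a).toRingHom :=
    RingHom.ext fun x => toDeckAway_algebraMap a x
  rw [← e, CommRingCat.ofHom_comp, AlgebraicGeometry.Spec.map_comp]
  have H : CategoryTheory.IsIso (CommRingCat.ofHom (toDeckAway a)) :=
    inferInstanceAs (CategoryTheory.IsIso (deckRingEquivAway a).toCommRingCatIso.inv)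
  have := AlgebraicGeometry.IsOpenImmersion.of_isLocalization (S := Localization.Away (hBar a)) (hBar a)
  infer_instance

end Equiv

end Literature.AlgebraicGeometry.HodgeTheory.Q8Family

end
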